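import Summits.ResolutionOfSingularities.ResolutionOfSingularities.Theorems.PurelyInseparableDim4IsoSpineTheorem
import Summits.ResolutionOfSingularities.ResolutionOfSingularities.Theorems.PurelyInseparableDim4Perm2BoundOrigin
import Literature.AlgebraicGeometry.Resolution.PointBlowupKangaroo
import Mathlib.Logic.Equiv.Fintype
import HarnessLib
import HarnessLib.Audit.Tags

/-!
# Purely inseparable hypersurfaces `z^q + F(x)` in ANY number of variables — ISO-SPINE-PO for every
# finite index type (the `(3,1)` calibration lane and every `n`)
# [OURS · counted 0 · cell res-dim4-pi · desk WORD #32 (a) (ii)]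

Sequel of `PurelyInseparableDim4IsoSpineTheorem.lean` (`IsoSpine.noPointOnlySpineBranch : ∀ n q`, on
`Fin n`) and of the class-`(4,1)` frame file `…IsoSpineFrame.lean`.  The tree's coordinate-centre model
`CentreBlowup.CState σ K / step` (`PointBlowupShadeCentres.lean`) is written for an ARBITRARY finite index
type `σ`; the cell's `(3,1)` calibration lane (W3-5: `z^p + F(x₂,x₃,x₄)`, Cossart–Piltant's dimension) and
every other `n` therefore want T(n,q) and its frame form without the `Fin 4` dress.  This file provides:

* §1 `noPointOnlySpineBranch_fintype` — T for supports `Finset (σ → ℕ)`, any `[Fintype σ]`, by transport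
  along `Fintype.equivFin σ` (the move `m ↦ update m j (|m| − q)` commutes with reindexing);
* §2 the support dictionary at the chart origin for `CState σ K` (as in the frame file, now in `σ`):
  `coe_chartExponent_univ_sigma`, `support_step_origin_subset_sigma`, `legal_of_le_ordAlong_sigma`,
  `pointOnly_of_forall_not_permissible` (test the hyperplane centres `univ ∖ {k}`; needs two variables);
* §3 **`no_pointOnly_origin_branch_sigma`**: for every field `K`, every `q` and every finite `σ` with at
  least two elements there is no infinite chain `c : ℕ → CState σ K` of chart-ORIGIN point blow-ups
  (`c (k+1) = step q univ j 0 (c k)`) all of whose states are `q`-fold (`q ≤ ord_{univ}`) and POINT-ONLY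
  (no nonempty proper `S` with `q ≤ ord_S F`).

Degenerate note: with ONE variable the statement is false as worded (`F = 0` is `q`-fold for ever and has
no proper nonempty centre to fail), whence `[Nontrivial σ]`.  Nothing here is a statement about resolution
of singularities; resolution in dimension ≥ 4 / characteristic `p` is NOT proved anywhere in this
programme; counted 0; AI formalisation, weaker than expert review.
bears_on: LADDER-RESOLUTION:D157-DOOR2 (res-dim4-pi · ISO-SPINE-PO any n). Supports stmt-ResolutionOfSingularities-16155 (helper).
-/

set_option linter.dupNamespace false

noncomputable section

open MvPolynomial Finset

namespace Summit.ResolutionOfSingularities.ResolutionOfSingularities.Theorems.PIDim4.IsoSpine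

open Literature.AlgebraicGeometry.Resolution
open Literature.AlgebraicGeometry.Resolution.Hauser2010
open Literature.AlgebraicGeometry.Resolution.CentreBlowup

/-! ## 1. T for any finite index type, by transport to `Fin n` -/

/-- Reindexing a monomial along `e : σ ≃ Fin n` does not change its total degree. [folklore] -/
theorem sum_comp_symm {σ : Type*} [Fintype σ] {n : ℕ} (e : σ ≃ Fin n) (m : σ → ℕ) :
    ∑ i, (m ∘ e.symm) i = ∑ i, m i :=
  Fintype.sum_equiv e.symm (fun i => (m ∘ e.symm) i) m fun _ => rfl

/-- The chart-origin move commutes with reindexing. [folklore] -/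
theorem spineMove_comp_symm {σ : Type*} [Fintype σ] [DecidableEq σ] {n : ℕ} (e : σ ≃ Fin n)
    (q : ℕ) (j : σ) (m : σ → ℕ) :
    spineMove q (e j) (m ∘ e.symm) = (Function.update m j ((∑ i, m i) - q)) ∘ e.symm := by
  unfold spineMove
  rw [sum_comp_symm, Function.update_comp_equiv m e.symm j, Equiv.symm_symm]

/-- **T(σ,q) for every finite index type**: there is no infinite sequence of legal point-only supports
`A₀, A₁, … ⊆ (σ → ℕ)` with `A_{t+1} ⊆ σ_{j_t}(A_t)` (chart-origin exponent law, arbitrary deletions).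
[folklore] -/
theorem noPointOnlySpineBranch_fintype {σ : Type*} [Fintype σ] [DecidableEq σ] (q : ℕ) :
    ¬ ∃ (A : ℕ → Finset (σ → ℕ)) (j : ℕ → σ),
      ∀ t, (∀ m ∈ A t, q ≤ ∑ i, m i) ∧ (∀ k : σ, ∃ m ∈ A t, (∑ i, m i) - m k < q) ∧
        A (t + 1) ⊆ (A t).image fun m => Function.update m (j t) ((∑ i, m i) - q) := by
  classical
  rintro ⟨A, j, h⟩
  set e := Fintype.equivFin σ with he
  refine noPointOnlySpineBranch (Fintype.card σ) q
    ⟨fun t => (A t).image fun m => m ∘ e.symm, fun t => e (j t), fun t => ⟨?_, ?_, ?_⟩⟩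
  · intro x hx
    obtain ⟨m, hm, rfl⟩ := Finset.mem_image.mp hx
    rw [sum_comp_symm]
    exact (h t).1 m hm
  · intro k
    obtain ⟨m, hm, hmk⟩ := (h t).2.1 (e.symm k)
    refine ⟨m ∘ e.symm, Finset.mem_image_of_mem _ hm, ?_⟩
    rw [sum_comp_symm]
    exact hmk
  · intro x hx
    obtain ⟨m', hm', rfl⟩ := Finset.mem_image.mp hx
    obtain ⟨m, hm, rfl⟩ := Finset.mem_image.mp ((h t).2.2 hm')
    rw [Finset.image_image]
    refine Finset.mem_image.mpr ⟨m, hm, ?_⟩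
    show spineMove q (e (j t)) (m ∘ e.symm) = _
    exact spineMove_comp_symm e q (j t) m

/-! ## 2. The support dictionary at the chart origin, any `σ` -/

section Dictionary

variable {σ : Type*} [Fintype σ] [DecidableEq σ] {K : Type*} [Field K]

/-- The exponent law of the point blow-up in the chart `j` is the move `m_j ← |m| − q` on coefficient
functions. [cite: HauserPerlega2019PRIMS, §2 (the blowup in the x₁-chart)] -/
theorem coe_chartExponent_univ_sigma (q : ℕ) (j : σ) (d : σ →₀ ℕ) :
    ⇑(CentreBlowup.chartExponent q Finset.univ j d) = Function.update ⇑d j ((∑ i, d i) - q) := by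
  unfold CentreBlowup.chartExponent
  rw [Finsupp.coe_update, degIn_univ, Finsupp.degree_eq_sum]

omit [DecidableEq σ] in
/-- `q ≤ ord_{univ} F` makes the support a legal position. [folklore] -/
theorem legal_of_le_ordAlong_sigma {q : ℕ} {F : MvPolynomial σ K}
    (h : (q : ℕ∞) ≤ CentreBlowup.ordAlong Finset.univ F) :
    ∀ m ∈ F.support.image (fun d : σ →₀ ℕ => (⇑d : σ → ℕ)), q ≤ ∑ i, m i := by
  intro a ha
  obtain ⟨d, hd, rfl⟩ := Finset.mem_image.mp ha
  have h1 := (le_ordAlong_iff.mp h) d hd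
  rw [degIn_univ, Finsupp.degree_eq_sum] at h1
  exact_mod_cast h1

/-- If NO nonempty proper coordinate centre is permissible (`q ≤ ord_S F` fails for every
`∅ ≠ S ≠ univ`) and there are at least two variables, the support is point-only. [folklore] -/
theorem pointOnly_of_forall_not_permissible [Nontrivial σ] {q : ℕ} {F : MvPolynomial σ K}
    (h : ∀ S : Finset σ, S ≠ Finset.univ → S.Nonempty → ¬ (q : ℕ∞) ≤ CentreBlowup.ordAlong S F) :
    ∀ k : σ, ∃ m ∈ F.support.image (fun d : σ →₀ ℕ => (⇑d : σ → ℕ)), (∑ i, m i) - m k < q := by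
  intro k
  obtain ⟨k', hk'⟩ := exists_ne k
  have hS : Finset.univ.erase k ≠ (Finset.univ : Finset σ) := fun hE => by
    have := hE ▸ Finset.notMem_erase k Finset.univ
    exact this (Finset.mem_univ k)
  have hne : (Finset.univ.erase k : Finset σ).Nonempty :=
    ⟨k', Finset.mem_erase.mpr ⟨hk', Finset.mem_univ _⟩⟩
  have hnot := h _ hS hne
  rw [le_ordAlong_iff] at hnot
  push Not at hnot
  obtain ⟨d, hd, hlt⟩ := hnot
  refine ⟨⇑d, Finset.mem_image_of_mem _ hd, ?_⟩
  have hdeg := Perm2Bound.degIn_eq_add_degIn_erase (Finset.mem_univ k) d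
  rw [degIn_univ, Finsupp.degree_eq_sum] at hdeg
  have hlt' : degIn (Finset.univ.erase k) d < q := by exact_mod_cast hlt
  omega

variable [DecidableEq K]

/-- The support of a chart-origin step lies in the moved support (cleaning deletes, `translate 0 = id`,
the chart transform moves exponents). [folklore] -/
theorem support_step_origin_subset_sigma (q : ℕ) (j : σ) (s : CState σ K) :
    ((CentreBlowup.step q Finset.univ j (0 : σ → K) s).F.support.image
        fun d : σ →₀ ℕ => (⇑d : σ → ℕ)) ⊆
      (s.F.support.image fun d : σ →₀ ℕ => (⇑d : σ → ℕ)).image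
        fun m => Function.update m j ((∑ i, m i) - q) := by
  intro a ha
  obtain ⟨E, hE, rfl⟩ := Finset.mem_image.mp ha
  change E ∈ (deletePthPowers q (PointBlowup.translate (0 : σ → K)
    (CentreBlowup.chartTransform q Finset.univ j s.F))).support at hE
  rw [PointBlowup.translate_zero, MvPolynomial.mem_support_iff, coeff_deletePthPowers] at hE
  have hE' : E ∈ (CentreBlowup.chartTransform q Finset.univ j s.F).support := by
    rw [MvPolynomial.mem_support_iff]
    intro h0
    rw [h0, ite_self] at hE
    exact hE rfl
  obtain ⟨e, he, rfl⟩ := Perm2Bound.exists_of_mem_support_chartTransform q Finset.univ j s.F hE'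
  rw [Finset.image_image]
  exact Finset.mem_image.mpr ⟨e, he, (coe_chartExponent_univ_sigma q j e).symm⟩

end Dictionary

/-! ## 3. The frame form in any number (`≥ 2`) of variables -/

/-- **ISO-SPINE-PO in any number of variables** (every field, every `q`, every finite `σ` with two or
more elements): there is no infinite chain of chart-ORIGIN point blow-ups `c (k+1) = step q univ j 0 (c k)`
in the tree's model `CentreBlowup.CState σ K` all of whose states are `q`-fold (`q ≤ ord_{univ} F`) and
POINT-ONLY (no nonempty proper coordinate centre `V(x_S)` with `q ≤ ord_S F`).  The class-`(4,1)`
instance is `noPointOnlySpineBranchF`; this is the `(3,1)`-lane / any-`n` form. [folklore] -/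
theorem no_pointOnly_origin_branch_sigma {σ : Type*} [Fintype σ] [DecidableEq σ] [Nontrivial σ]
    (q : ℕ) (K : Type*) [Field K] [DecidableEq K] :
    ¬ ∃ c : ℕ → CState σ K, ∀ k,
      (q : ℕ∞) ≤ CentreBlowup.ordAlong Finset.univ (c k).F ∧
      (∀ S : Finset σ, S ≠ Finset.univ → S.Nonempty →
        ¬ (q : ℕ∞) ≤ CentreBlowup.ordAlong S (c k).F) ∧
      ∃ j : σ, c (k + 1) = CentreBlowup.step q Finset.univ j (0 : σ → K) (c k) := by
  rintro ⟨c, hc⟩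
  have hj : ∀ k, ∃ j : σ, c (k + 1) = CentreBlowup.step q Finset.univ j (0 : σ → K) (c k) :=
    fun k => (hc k).2.2
  choose j hj using hj
  refine noPointOnlySpineBranch_fintype (σ := σ) q
    ⟨fun k => (c k).F.support.image fun d : σ →₀ ℕ => (⇑d : σ → ℕ), j, fun k => ?_⟩
  refine ⟨legal_of_le_ordAlong_sigma (hc k).1, pointOnly_of_forall_not_permissible (hc k).2.1, ?_⟩
  show ((c (k + 1)).F.support.image fun d : σ →₀ ℕ => (⇑d : σ → ℕ)) ⊆
    ((c k).F.support.image fun d : σ →₀ ℕ => (⇑d : σ → ℕ)).image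
      fun m => Function.update m (j k) ((∑ i, m i) - q)
  rw [hj k]
  exact support_step_origin_subset_sigma q (j k) (c k)

end Summit.ResolutionOfSingularities.ResolutionOfSingularities.Theorems.PIDim4.IsoSpine

end
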